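import Literature.NumberTheory.Automorphic.Liu2021.SplitPlaceMixedModelSmooth
import HarnessLib

/-!
# The centre `U(J₁)(F_v) ≅ F_vˣ` at a split place, for an arbitrary non-degenerate line `J₁`

Topic `NumberTheory/Automorphic/Liu2021`; namespace `Literature.NumberTheory.Automorphic.Liu2021.SplitPlaceMixedModel`
(sequel of `SplitPlaceMixedModel.lean`, `SplitPlaceMixedModelSmooth.lean`).  KERNEL ONLY: theorems; no definition, no
named fact, no `sorry`.

For a line `J₁ = (j)`, `j ≠ 0` (NOT necessarily hermitian — the named fact `splitPlace_chiCoinv_iso_parabolicIndGL`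
quantifies over every such `J₁`), the local unitary group `U(J₁)(F_v) ≤ Π_{w' ∣ v} GL_1(E_{w'})` does not depend on
`j` (`localPi_eq_localPi_one`: the defining relation `c_*(z_{c⁻¹w'}) j z_{w'} = j` is `c_*(z_{c⁻¹w'}) z_{w'} = 1`), so at
a SPLIT place `w ∣ v` it is identified with `E_wˣ = F_vˣ` by `z ↦ ι_w⁻¹((z_w)₀₀)` (tree `localPiSplitEquiv` for the
hermitian line `1`): `exists_centre_mulEquiv` — **a group isomorphism `T : U(J₁)(F_v) ≃* F_vˣ` with `ι_w(T z) = (z_w)₀₀`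
and continuous inverse**; consequently (`localCenter_eq_symm_map_scalar`) the local centre is `localCenter z = κ_{T z · 1_N}`
in the coordinates of the mixed model.  [Mok2014, §1 Notation p. 5]: «for `v` split `U(N)(F_v) ≅ GL_N(F_v)`» with
`N = 1`.  Part of the KEY `b4-split-place-model` (cell hodgecm-mathlib); HC_CM is not mentioned further.
-/

set_option autoImplicit false

noncomputable section

open NumberField IsDedekindDomain Matrix
open Literature.NumberTheory.Automorphic Literature.NumberTheory.Automorphic.UnitaryGroup
open Literature.NumberTheory.GelbartRogawski1991.UnitaryDualPair.LocalSplitting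

namespace Literature.NumberTheory.Automorphic.Liu2021.SplitPlaceMixedModel

/-! ## §1 `1 × 1` matrices -/

section OneByOne

variable {R : Type*} [CommRing R]

/-- entries of a product of `1 × 1` matrices. [folklore] -/
private theorem mul_apply_fin_one (A B : Matrix (Fin 1) (Fin 1) R) : (A * B) 0 0 = A 0 0 * B 0 0 := by
  rw [Matrix.mul_apply, Fin.sum_univ_one]

omit [CommRing R] in
/-- a `1 × 1` matrix is determined by its entry. [folklore] -/
private theorem ext_fin_one {A B : Matrix (Fin 1) (Fin 1) R} (h : A 0 0 = B 0 0) : A = B := by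
  ext i j
  rw [Fin.eq_zero i, Fin.eq_zero j]
  exact h

/-- for `1 × 1` matrices with `P₀₀` not a zero divisor (here: in a field, non-zero): `Aᵀ P B = P ↔ Aᵀ B = 1`.
[folklore] -/
private theorem transpose_mul_mul_eq_iff {K : Type*} [Field K] (A B P : Matrix (Fin 1) (Fin 1) K) (hP : P 0 0 ≠ 0) :
    Aᵀ * P * B = P ↔ Aᵀ * B = 1 := by
  constructor
  · intro h
    apply ext_fin_one
    have h' := congrArg (fun M : Matrix (Fin 1) (Fin 1) K => M 0 0) h
    simp only [mul_apply_fin_one, Matrix.transpose_apply] at h'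
    rw [mul_apply_fin_one, Matrix.transpose_apply, Matrix.one_apply_eq]
    have : A 0 0 * B 0 0 * P 0 0 = 1 * P 0 0 := by rw [one_mul]; linear_combination h'
    exact mul_right_cancel₀ hP this
  · intro h
    apply ext_fin_one
    have h' := congrArg (fun M : Matrix (Fin 1) (Fin 1) K => M 0 0) h
    simp only [mul_apply_fin_one, Matrix.transpose_apply, Matrix.one_apply_eq] at h'
    rw [mul_apply_fin_one, mul_apply_fin_one, Matrix.transpose_apply]
    calc A 0 0 * P 0 0 * B 0 0 = (A 0 0 * B 0 0) * P 0 0 := by ring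
      _ = P 0 0 := by rw [h', one_mul]

end OneByOne

/-! ## §2 `U(J₁)(F_v)` does not depend on the non-zero entry of `J₁` -/

section Place

variable (F : Type) [Field F] [NumberField F] (E : Type) [Field E] [NumberField E] [Algebra F E]
  [Algebra.IsQuadraticExtension F E] (c : E ≃ₐ[F] E) (v : HeightOneSpectrum (𝓞 F))

omit [Algebra.IsQuadraticExtension F E] in
/-- **`U(J₁)(F_v) = U(1)(F_v)` for every line `J₁ = (j)` with `j ≠ 0`**: the defining relation at each place `w' ∣ v`,
`c_*(z_{c⁻¹w'})ᵀ · j · z_{w'} = j`, is equivalent to `c_*(z_{c⁻¹w'}) z_{w'} = 1`. [cite: Mok2014, §1 Notation p. 5] -/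
theorem localPi_eq_localPi_one {J₁ : Matrix (Fin 1) (Fin 1) E} (hJ₁ : J₁ 0 0 ≠ 0) :
    localPi E c 1 J₁ v = localPi E c 1 (1 : Matrix (Fin 1) (Fin 1) E) v := by
  ext u
  rw [mem_localPi_iff, mem_localPi_iff]
  refine forall_congr' fun w => ?_
  have hP : (placeForm J₁ w.1) 0 0 ≠ 0 := by
    change algebraMap E (w.1.adicCompletion E) (J₁ 0 0) ≠ 0
    exact (map_ne_zero _).2 hJ₁
  have h1 : placeForm (1 : Matrix (Fin 1) (Fin 1) E) w.1 = 1 := by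
    change (1 : Matrix (Fin 1) (Fin 1) E).map (algebraMap E (w.1.adicCompletion E)) = 1
    rw [Matrix.map_one _ (map_zero _) (map_one _)]
  rw [transpose_mul_mul_eq_iff _ _ _ hP, h1, Matrix.mul_one]

omit [NumberField F] [NumberField E] [Algebra.IsQuadraticExtension F E] in
/-- the identity line `1` is hermitian: `(1.map c)ᵀ = 1`. [folklore] -/
private theorem one_hermitian : ((1 : Matrix (Fin 1) (Fin 1) E).map c)ᵀ = 1 := by
  rw [Matrix.map_one _ (map_zero c) (map_one c), Matrix.transpose_one]

/-- the identity line is invertible at every place. [folklore] -/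
private theorem isUnit_placeForm_one (w : HeightOneSpectrum (𝓞 E)) : IsUnit (placeForm (1 : Matrix (Fin 1) (Fin 1) E) w) := by
  have : placeForm (1 : Matrix (Fin 1) (Fin 1) E) w = 1 := by
    change (1 : Matrix (Fin 1) (Fin 1) E).map (algebraMap E (w.adicCompletion E)) = 1
    rw [Matrix.map_one _ (map_zero _) (map_one _)]
  rw [this]; exact isUnit_one

/-- `GL_1(R) ≃* Rˣ` by the determinant (= the entry), with inverse the scalar matrices. [folklore] -/
private theorem exists_mulEquiv_GL_one (R : Type*) [CommRing R] [TopologicalSpace R] [IsTopologicalRing R] :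
    ∃ d : GL (Fin 1) R ≃* Rˣ, (∀ g, ((d g : Rˣ) : R) = ((g : GL (Fin 1) R) : Matrix (Fin 1) (Fin 1) R) 0 0) ∧
      (∀ r : Rˣ, d.symm r = Units.map (Matrix.scalar (Fin 1)).toMonoidHom r) ∧ Continuous d.symm := by
  have hds : ∀ r : Rˣ, Matrix.GeneralLinearGroup.det (Units.map (Matrix.scalar (Fin 1)).toMonoidHom r) = r := by
    intro r; ext
    rw [Matrix.GeneralLinearGroup.val_det_apply, Units.coe_map, RingHom.toMonoidHom_eq_coe, MonoidHom.coe_coe,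
      Matrix.scalar_apply, Matrix.det_diagonal, Fin.prod_univ_one]
  have hsd : ∀ g : GL (Fin 1) R, Units.map (Matrix.scalar (Fin 1)).toMonoidHom (Matrix.GeneralLinearGroup.det g) = g := by
    intro g; apply Units.ext
    rw [Units.coe_map, RingHom.toMonoidHom_eq_coe, MonoidHom.coe_coe, Matrix.scalar_apply,
      Matrix.GeneralLinearGroup.val_det_apply, Matrix.det_eq_elem_of_subsingleton _ 0]
    exact ext_fin_one (by rw [Matrix.diagonal_apply_eq])
  let d : GL (Fin 1) R ≃* Rˣ := MonoidHom.toMulEquiv Matrix.GeneralLinearGroup.det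
    (Units.map (Matrix.scalar (Fin 1)).toMonoidHom) (MonoidHom.ext hsd) (MonoidHom.ext hds)
  have hd : ∀ g, d g = Matrix.GeneralLinearGroup.det g := fun g => rfl
  have hd' : ∀ r, d.symm r = Units.map (Matrix.scalar (Fin 1)).toMonoidHom r := fun r => rfl
  refine ⟨d, fun g => ?_, hd', ?_⟩
  · rw [hd, Matrix.GeneralLinearGroup.val_det_apply, Matrix.det_eq_elem_of_subsingleton _ 0]
  · have heq : (d.symm : Rˣ → GL (Fin 1) R) = Units.map (Matrix.scalar (Fin 1)).toMonoidHom := funext hd'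
    rw [heq]
    have hsc : Continuous fun r : R => Matrix.scalar (Fin 1) r := by
      have heq : (fun r : R => Matrix.scalar (Fin 1) r) = fun r => Matrix.diagonal fun _ : Fin 1 => r :=
        funext fun r => Matrix.scalar_apply r
      rw [heq]
      exact (continuous_pi fun _ => continuous_id).matrix_diagonal
    exact Continuous.units_map (Matrix.scalar (Fin 1)).toMonoidHom (by exact hsc)

variable {δ : E} (hcδ : c δ = -δ) (hδ : δ ≠ 0) {d : F} (hd : δ * δ = algebraMap F E d)

include hcδ hδ hd in
/-- **The centre at a split place: `T : U(J₁)(F_v) ≃* F_vˣ` with `ι_w(T z) = (z_w)₀₀` and continuous inverse**, for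
every line `J₁ = (j)`, `j ≠ 0` (tree `localPiSplitEquiv` for the hermitian line `1`, `localPi_eq_localPi_one`,
`GL_1 ≅ GL₁` by the determinant, and `ι_w : F_v ≅ E_w` onto at a split place). [cite: Mok2014, §1 Notation p. 5] -/
theorem exists_centre_mulEquiv (hc : c ≠ 1) (w : UnitaryGroup.PlacesOver E v) (hw : c • w.1 ≠ w.1)
    {J₁ : Matrix (Fin 1) (Fin 1) E} (hJ₁ : J₁ 0 0 ≠ 0) :
    ∃ T : localPi E c 1 J₁ v ≃* (v.adicCompletion F)ˣ,
      (∀ z, toPlace v w ((T z : (v.adicCompletion F)ˣ) : v.adicCompletion F) =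
        (((z : LocalGLPi E 1 v) w : GL (Fin 1) (w.1.adicCompletion E)) : Matrix (Fin 1) (Fin 1) (w.1.adicCompletion E)) 0 0) ∧
      Continuous (T.symm : (v.adicCompletion F)ˣ → localPi E c 1 J₁ v) := by
  -- the pieces
  let e₀ : localPi E c 1 J₁ v ≃* localPi E c 1 (1 : Matrix (Fin 1) (Fin 1) E) v :=
    MulEquiv.subgroupCongr (localPi_eq_localPi_one F E c v hJ₁)
  let e₁ := localPiSplitEquiv c (1 : Matrix (Fin 1) (Fin 1) E) hc (one_hermitian F E c) w hw (isUnit_placeForm_one E w.1)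
  obtain ⟨dw, hdw, hdw_symm, hdw_cont⟩ := exists_mulEquiv_GL_one (w.1.adicCompletion E)
  let ιw : v.adicCompletion F ≃+* w.1.adicCompletion E :=
    RingEquiv.ofBijective (toPlace v w) ⟨(toPlace v w).injective, toPlace_surjective F E c hcδ hδ hd v w hw⟩
  let T : localPi E c 1 J₁ v ≃* (v.adicCompletion F)ˣ :=
    e₀.trans (e₁.toMulEquiv.trans (dw.trans (Units.mapEquiv ιw.symm.toMulEquiv)))
  refine ⟨T, fun z => ?_, ?_⟩
  · change toPlace v w (ιw.symm (dw (e₁ (e₀ z)) : w.1.adicCompletion E)) = _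
    rw [show toPlace v w (ιw.symm (dw (e₁ (e₀ z)) : w.1.adicCompletion E)) = ιw (ιw.symm _) from rfl,
      RingEquiv.apply_symm_apply, hdw, localPiSplitEquiv_apply]
    rfl
  · -- `T⁻¹ = e₀⁻¹ ∘ e₁⁻¹ ∘ dw⁻¹ ∘ (ι_w)_*`
    have hcont₀ : Continuous (e₀.symm : localPi E c 1 (1 : Matrix (Fin 1) (Fin 1) E) v → localPi E c 1 J₁ v) :=
      Continuous.subtype_mk continuous_subtype_val _
    have hcontι : Continuous (Units.map (ιw : v.adicCompletion F →+* w.1.adicCompletion E).toMonoidHom) :=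
      Continuous.units_map _ (continuous_toPlace v w)
    have : (T.symm : (v.adicCompletion F)ˣ → localPi E c 1 J₁ v) =
        fun u => e₀.symm (e₁.symm (dw.symm (Units.map (ιw : v.adicCompletion F →+* w.1.adicCompletion E).toMonoidHom u))) := by
      funext u; rfl
    rw [this]
    exact hcont₀.comp (e₁.symm.continuous.comp (hdw_cont.comp hcontι))

end Place

end Literature.NumberTheory.Automorphic.Liu2021.SplitPlaceMixedModel

end
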